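import Summits.AtomisticToContinuum.Crystallization.Theorems.ChartedZeroExcessLayeredLatticeLiouvilleQ

/-!
# Zero-excess layered lattice Liouville — part R (lens-2 g30, node «TruncatedHarmonicSplit»): the regularity leaf (HD) DECOMPOSED

Target (critic row 515 (iii), VERBATIM tree decl of part Q): `HarmonicDecayPGL aHi Λ θ s s'` — «registered-flat at `(R, η)` under an
equilibrium `s`-conformal chart ⇒ registered-flat at `(t·R, c·η)` under an equilibrium `s'`-conformal chart, for every contraction target `c`
(∀c ∃t)» on θ-good GSC door sets.  Column instance `(aHi; Λ, θ, s, s') = (1; 2, 1/16, 1/50, 1/25)`.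

## D-g29-1 EXECUTED under the RULED convention (critic row 515 (iii)): TRUNCATED kernel + Dirichlet collar + tail certificate
A «window-harmonic field» for the NONLOCAL layered Lennard-Jones force-constant kernel is typed as `IsTruncHarmonic ϱ H h P`: at every site
`p ∈ P` the TRUNCATED linearised force `Σ_{q ∈ H, |q − p| ≤ ϱ} K(q − p)(h q − h p)` vanishes, as a `HasSum` over the (finite, for a clean model)
subtype — no junk value; every model site outside `P` is Dirichlet data (the collar is «everything beyond `P`», of width `≥ ϱ` inside the region
where `h` carries a gradient profile).  The range `ϱ` is a BOUND VARIABLE, literal-free: the approximation piece (A) chooses it (∀ defect target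
∃ ϱ), the decay piece (D) is uniform in `ϱ ≥ ϱ₁`, and the price of truncation is the configuration-free TAIL certificate (T) (long bonds are
dominated by nearest-neighbour bonds in the second-moment = `H¹ → H⁻¹` sense, `ε(ϱ) → 0`; numerics of record: lens-3 `hessTail 15/2 ≤ 3/2000`).
NOT typed (ruled out, FALSE-type risk): raw-kernel harmonicity with a weighted exterior growth bound.  A FIXED literal range cannot serve (HD)'s
«∀ c»: the truncation defect has the floor `θ(ϱ)·η`, and `c ↦ t(c) ~ √c` makes `t⁻³ θ(ϱ) η ≫ c η` as `c → 0` (FIXED-RANGE FLOOR).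

## The new currency `NearHarmSplitE` (STRUCTURED ⊕ GENERIC at the displacement level) and why it has no body force and no position clause
`IsHarmSplit ϱ κh κd r ρ S H Ψ h σ τ`: a TEAR-FREE injective registration `Ψ` of the root window `win ρ := atomsIn (μS S) 0 ρ` into the model `H`
(registered `r`-neighbours go to `2r`-neighbours — pointwise sanity absent from `IsRegistered`, whose profile is only `ℓ²`); a STRUCTURED part
`h : E3 → E3` living on the MODEL, truncated-harmonic on the model ball `H ∩ B(Ψ 0, 4ρ)` with gradient profile `σ` on `H ∩ B(Ψ 0, 8ρ)` at level
`κh` (model-geometric regions: no hole of the registration is exempt from harmonicity — an image-indexed region would let a non-harmonic ramp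
hide a registration hole inside `κh`); a GENERIC part, the defect `d x := (x − Ψ x) − h (Ψ x)` with gradient profile `τ` at level `κd`.
Defect-free ⟺ the registered displacement IS (the trace of) a truncated-harmonic model field — the clause with teeth.  NO constant body force in
the structured class: force balance of the Nash configuration slaves every far-field force difference to the window's own level
(`‖G‖_{H⁻¹(B_R)} ≲ √(η·#)`), and its smoothness on scale `R` (sources `≥ R/2` away; three-ball analyticity) turns the shrink factor `M` of (A) into
the gains `M⁻²` (mean force, Dirichlet bubble) and `M⁻⁴` (variation) — so the far field is GENERIC at `c' ~ M⁻²`, not structured.  NO position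
clause: on a clean window the position level is regenerated from the gradient level by the discrete Poincaré inequality after a free translation
of the chart (`w ↦ w + v` keeps `IsEquilChart`), inside (D).

## The cut (lens «structural dichotomy», now visible in the EXPONENTS: structured decays `t²`, generic is carried at `t⁻³`)
`(HD)(aHi;Λ,θ,s,s') ⟸ (T) TailDominationCert ∧ (U) UniformEquilStability s Λ ∧ (A) HarmonicApproxPGL(aHi;Λ,θ,s) ∧ (D) SplitDecayPL(aHi;Λ,θ,s,s')`
— PROVED (`harmonicDecayPGL_of_tail_unif_approx_decay`, pure real bookkeeping: `t₀ := min (1/2) (c/(2 C_d C_A + c))`, defect target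
`c' := c t₀³/(2 C_d)`, HD's ratio `t := t₀ / M`, so that `C_d (t₀² C_A + c'/t₀³) η ≤ c η`).
* (T) configuration-free, LINEAR·M: long-bond second moments of the layered LJ kernel of a co-Lipschitz crystal `≤ ε · nnFormZ`, `∀ ε ∃ ϱ₀`.
* (U) STABILITY, INSTRUMENTABLE (census TAG 174 (a⁗) equilibrium slice, CHAIN-MARGIN): equilibrium charts are UNIFORMLY coercive in the
      layer-local currency after a uniformly co-Lipschitz re-indexing of their layers — the uniform form of the column leaf `LayeredCrystalStability`
      restricted to equilibrium charts; it is where EVERY use of Hessian positivity of this node is routed (row 508/515 discipline).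
* (A) MINIMALITY + REGISTRATION, L — THE NEW RESIDUAL-DESIGNATE: the registered displacement of a θ-good e⋆-GSC door set splits, on the window
      shrunk by `M(c')`, into a truncated-harmonic model field (level `C_A η`, `C_A` INDEPENDENT of `c'`) plus a defect of level `c' η`, for EVERY
      `c' > 0` and every prescribed range floor `ϱ₁` (discrete harmonic approximation by minimality transfer to the truncated quadratic Dirichlet
      energy, coercive by (U) − (T); cubic Taylor error needs the ε-regularity of the bad set; tears repaired by registration surgery; far field generic).
* (D) LINEAR + RE-CHART, M–L, GSC-FREE BY TYPE (door `IsDoorSetP`): split data at `(ρ; κh, κd)` ⇒ registered-flat at `t ρ` under a NEW equilibrium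
      `s'`-chart at level `C_d (t² κh + κd / t³)`, uniformly in the range `ϱ ≥ ϱ₁` (interior Campanato decay of truncated-harmonic fields on
      equilibrium charts + affine-layered Taylor part ↦ chart `(I+B)L`, re-equilibration `O(κh²)`, Poincaré, two-sided `EnvClose` re-derived from
      cleanliness with the non-surjective sites charged to the defect).
Columns `_16XH4` (TWELVE opaque leaves: LLC, LLC′, R_G, X, Z_E, P, T, U, A, D, C, HBG″) and its resolved 16-leaf audit form.
0 EQUIV.  Every new `def` is a `Prop` or a `Prop`-valued predicate; no instance / notation / set_option.

## (C)'s collar deletion — particle-number bookkeeping (critic row 515, asked to be stated): the door IS the μ-form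
`IsEStarGSC μ` (tree, VERBATIM shape): for every finite replacement «delete `n` atoms `xf`, insert `k` atoms `R`» the inequality compares
`interactionEnergy(xf) + Σ… − e⋆·n ≤ interactionEnergy(R) + Σ… − e⋆·k` — deleted and inserted particle numbers `n ≠ k` are allowed and priced at
the chemical potential `μ = e⋆` each.  Hence (C)'s competitor «delete the Chebyshev-bad collar atoms» (fewer atoms, `k < n`) is admissible and
costs `|e⋆|` per deleted atom — no re-insertion at clean sites is needed; the canonical reading does not arise.
-/

noncomputable section

open scoped BigOperators InnerProductSpace RealInnerProductSpace
open MeasureTheory Set Metric Filter Topology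
open Summit.AtomisticToContinuum.Crystallization.Theorems.ChartedPlanarOrderRigidityDoor
  (E3 IsClean IsNash IsCharted IsEStarGSC VisibleGap PertRegime atomsIn siteEnergy eStar BindingSurface)
open Summit.AtomisticToContinuum.Crystallization.Theorems.ChartedPlanarOrderDensityDichotomy (μS IsSep nK nK_nonneg excess)
open Summit.AtomisticToContinuum.Crystallization.Theorems.ChartedPlanarOrderMesoCut (IsDoorSet NearHom LayeredHom EnvClose)
open Summit.AtomisticToContinuum.Crystallization.Theorems.OverbindingBudgetLiouvilleDictionary (NearHomBD)
open Summit.AtomisticToContinuum.Crystallization.Theorems.ChartedPlanarOrderDoorLayered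
  (TwoPeriodic DoorPeriodic PeriodicBulkGapDoor gap_and_pert_1_50_of_periodic NearHomL2BD nearHomL2BD_mono nearHomBD_of_nearHomL2BD
   sq_le_finsum_mem not_nearHomL2BD_singleton envClose_mono Layered layeredHom_eq_layered atomsIn_subset)
open Summit.AtomisticToContinuum.Crystallization.Theorems.ChartedPlanarOrderDoorLayeredOsc (IsTwoShellAffineGood DoorPeriodicOsc)
open Summit.AtomisticToContinuum.Crystallization.Theorems.ChartedPlanarOrderCleanScaleP
  (IsCleanP IsDoorSetP DoorPeriodicP isDoorSetP_mono doorPeriodic_of_doorPeriodicP isDoorSetP_one_iff doorPeriodicP_one_iff)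
open Literature.MathematicalPhysics.StatisticalMechanics (haggLabel barlowOffset layerNormal IsHaggSeq triangularVec₁ triangularVec₂)

namespace Summit.AtomisticToContinuum.Crystallization.Theorems.ChartedZeroExcessLayeredLatticeLiouville

/-! ## §III.1  The split currency `IsTruncHarmonic`, `IsHarmSplit`, `NearHarmSplitE` (definition request D-g29-1, ruled form) -/

/-- **truncated harmonicity** (range `ϱ`, NO body force) of a model field `h : E3 → E3` at the sites of `P` with respect to the model `H`: at every
`p ∈ P` the truncated linearised force `Σ_{q ∈ H ∩ B̄(p, ϱ)} K(q − p)(h q − h p) = 0` as a `HasSum` over the subtype (the `q = p` term is `0`;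
for a clean model the subtype is finite and this is a finite sum; a non-summable row cannot satisfy it — no junk).  Kernel convention = `layeredKernel`
/ `IsHarmonic` (bond `q − p`, increment `h q − h p`).  Sites of `H` outside `P` are Dirichlet data. [this file, g30] -/
def IsTruncHarmonic (ϱ : ℝ) (H : Set E3) (h : E3 → E3) (P : Set E3) : Prop :=
  ∀ p ∈ P, HasSum (fun q : ↥(H ∩ closedBall p ϱ) => forceConst ((q : E3) - p) (h (q : E3) - h p)) 0

/-- **split data** `IsHarmSplit ϱ κh κd r ρ S H Ψ h σ τ` on the root window `Q := atomsIn (μS S) 0 ρ`: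
(reg) `Ψ` injects `Q` into `H` and is TEAR-FREE (`r`-neighbours ↦ `2r`-neighbours);
(harm) STRUCTURED part: `h` is `ϱ`-truncated-harmonic at every model site of `H ∩ B̄(Ψ 0, 4ρ)`;
(σ) gradient profile of `h` on `H ∩ B̄(Ψ 0, 8ρ)`: `‖h q − h p‖ ≤ σ p` for model `r`-neighbours, level `∑ σ² ≤ κh · #Q`;
(τ) GENERIC part: the defect `d x := (x − Ψ x) − h (Ψ x)` has gradient profile `τ` over registered `r`-neighbours, level `∑ τ² ≤ κd · #Q`.
No `EnvClose`, no position clause (both regenerated downstream from cleanliness / Poincaré); no body force (see the module docstring). [this file, g30] -/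
def IsHarmSplit (ϱ κh κd r ρ : ℝ) (S H : Set E3) (Ψ : E3 → E3) (h : E3 → E3) (σ τ : E3 → ℝ) : Prop :=
  Set.InjOn Ψ (atomsIn (μS S) 0 ρ) ∧ Set.MapsTo Ψ (atomsIn (μS S) 0 ρ) H ∧
    (∀ x ∈ atomsIn (μS S) 0 ρ, ∀ p ∈ atomsIn (μS S) 0 ρ, dist p x ≤ r → dist (Ψ p) (Ψ x) ≤ 2 * r) ∧
    IsTruncHarmonic ϱ H h (H ∩ closedBall (Ψ 0) (4 * ρ)) ∧
    (∀ p ∈ H ∩ closedBall (Ψ 0) (8 * ρ), 0 ≤ σ p ∧ ∀ q ∈ H, dist q p ≤ r → ‖h q - h p‖ ≤ σ p) ∧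
    ∑ᶠ p ∈ H ∩ closedBall (Ψ 0) (8 * ρ), σ p ^ 2 ≤ κh * nK (atomsIn (μS S) 0 ρ) ∧
    (∀ x ∈ atomsIn (μS S) 0 ρ, 0 ≤ τ x ∧ ∀ p ∈ atomsIn (μS S) 0 ρ, dist p x ≤ r →
      ‖((p - Ψ p) - h (Ψ p)) - ((x - Ψ x) - h (Ψ x))‖ ≤ τ x) ∧
    ∑ᶠ x ∈ atomsIn (μS S) 0 ρ, τ x ^ 2 ≤ κd * nK (atomsIn (μS S) 0 ρ)

/-- ★★ **`NearHarmSplitE a s Λ ϱ κh κd r ρ S`** — the root window of `S` at radius `ρ` SPLITS under an EQUILIBRIUM `s`-conformal chart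
(`IsEquilChart a s Λ L w`, part Q) into a `ϱ`-truncated-harmonic model field at level `κh` and a defect at level `κd`.  The currency in which
(A) (output) and (D) (input) are stated. [this file, g30] -/
def NearHarmSplitE (a s Λ ϱ κh κd r ρ : ℝ) (S : Set E3) : Prop :=
  ∃ (L : E3 ≃L[ℝ] E3) (w : ℤ → E3), IsEquilChart a s Λ L w ∧
    ∃ (Ψ : E3 → E3) (h : E3 → E3) (σ τ : E3 → ℝ), IsHarmSplit ϱ κh κd r ρ S (LayeredHom (L : E3 →L[ℝ] E3) w) Ψ h σ τ

/-- a constant model field is truncated-harmonic everywhere (every range, every model). [this file, g30] -/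
theorem isTruncHarmonic_const (ϱ : ℝ) (H P : Set E3) (v : E3) : IsTruncHarmonic ϱ H (fun _ => v) P := by
  intro p _
  have h0 : (fun q : ↥(H ∩ closedBall p ϱ) => forceConst ((q : E3) - p) (v - v)) = fun _ => 0 := by
    funext q
    simp
  rw [h0]
  exact hasSum_zero

/-- split data are monotone in both levels. [this file, g30] -/
theorem IsHarmSplit.mono {ϱ κh κh' κd κd' r ρ : ℝ} (hh : κh ≤ κh') (hd : κd ≤ κd') {S H : Set E3} {Ψ : E3 → E3} {h : E3 → E3}
    {σ τ : E3 → ℝ} (hs : IsHarmSplit ϱ κh κd r ρ S H Ψ h σ τ) : IsHarmSplit ϱ κh' κd' r ρ S H Ψ h σ τ := by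
  obtain ⟨h1, h2, h3, h4, h5, h6, h7, h8⟩ := hs
  exact ⟨h1, h2, h3, h4, h5, h6.trans (mul_le_mul_of_nonneg_right hh (nK_nonneg _)), h7,
    h8.trans (mul_le_mul_of_nonneg_right hd (nK_nonneg _))⟩

/-- `NearHarmSplitE` is monotone in both levels. [this file, g30] -/
theorem nearHarmSplitE_mono {a s Λ ϱ κh κh' κd κd' r ρ : ℝ} (hh : κh ≤ κh') (hd : κd ≤ κd') {S : Set E3}
    (hs : NearHarmSplitE a s Λ ϱ κh κd r ρ S) : NearHarmSplitE a s Λ ϱ κh' κd' r ρ S := by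
  obtain ⟨L, w, hE, Ψ, h, σ, τ, hsp⟩ := hs
  exact ⟨L, w, hE, Ψ, h, σ, τ, hsp.mono hh hd⟩

/-- **non-junk inhabitant of the split clauses**: a root window of the model itself (`0 ≤ r`) is split by the identity registration with structured
part `h = 0` and defect `0`, at levels `(0, 0)` — the eight clauses are jointly satisfiable and say what they should on the model. [this file, g30] -/
theorem isHarmSplit_self (ϱ ρ : ℝ) {r : ℝ} (hr : 0 ≤ r) (H : Set E3) :
    IsHarmSplit ϱ 0 0 r ρ H H (fun x => x) (fun _ => 0) (fun _ => 0) (fun _ => 0) := by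
  refine ⟨fun x _ y _ hxy => hxy, fun x hx => atomsIn_subset H ρ hx, ?_, isTruncHarmonic_const ϱ H _ 0, ?_, by simp, ?_, by simp⟩
  · intro x _ p _ hpx
    linarith
  · intro p _
    exact ⟨le_rfl, fun q _ _ => by simp⟩
  · intro x _
    exact ⟨le_rfl, fun p _ _ => by simp⟩

/-- ★ **inhabitant of `NearHarmSplitE` modulo the chart class**: a root window of an EQUILIBRIUM chart splits at levels `(0, 0)` under it (identity
registration, zero structured part, zero defect). [this file, g30] -/
theorem nearHarmSplitE_self {a s Λ ϱ ρ r : ℝ} (hr : 0 ≤ r) {L : E3 ≃L[ℝ] E3} {w : ℤ → E3} (hE : IsEquilChart a s Λ L w) :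
    NearHarmSplitE a s Λ ϱ 0 0 r ρ (LayeredHom (L : E3 →L[ℝ] E3) w) :=
  ⟨L, w, hE, fun x => x, fun _ => 0, fun _ => 0, fun _ => 0, isHarmSplit_self ϱ ρ hr _⟩

/-! ## §III.2  The four pieces beneath (HD): (T) tail, (U) uniform equilibrium stability, (A) harmonic approximation, (D) split decay -/

/-- ★ **(T) «TailDominationCert»** — THE TAIL CERTIFICATE (configuration-free, LINEAR): for every co-Lipschitz constant `c > 0` and `ε > 0` there is
a range `ϱ₀` such that for every `ϱ ≥ ϱ₀`, every `c`-co-Lipschitz layered crystal `(a, b, w)` and every finitely supported test field `φ`, the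
long-bond part of the second moment `Σ_{|bond| > ϱ} ‖K_bond‖·‖φ q − φ p‖²` is summable and `≤ ε · nnFormZ φ` (long bonds dominated by nearest-neighbour
bonds: `‖K(e)‖ ≤ 38|e|⁻⁸`, telescoping along index paths of length `≤ |e|/c`, `#{e : |e| ≈ r} ≲ r²/c³`, so `ε(ϱ) ≲ Σ_{r>ϱ} r⁻⁴ ~ ϱ⁻³`).  Consumed by
(A) (in-window tail as an `H⁻¹` source, truncated coercivity `≥ κ₀ − ε`) and by (D) (decay constants uniform in the range).
UNDECIDED · TRUE-type · ATTACKABLE·M (pure analysis over tree objects; the equi-small-tail strengthening of `LayeredMoments`).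
Why it might fail: only through bookkeeping — the layered kernel is not translation-invariant in the layer index, so the telescoping bound must be
uniform over rows (co-Lipschitz gives it); numerics of record `hessTail(15/2) ≤ 3/2000` (lens-3, pair-modulus currency) indicate the size.
Sources: [this tree: `norm_forceConst_le`, `LayeredMoments`, `Moment₂Z`], [Theil2006 §4 (lattice sums)], [EMing2006]. [this file, g30] -/
def TailDominationCert : Prop :=
  ∀ c : ℝ, 0 < c → ∀ ε : ℝ, 0 < ε → ∃ ϱ₀ : ℝ, 0 < ϱ₀ ∧ ∀ ϱ : ℝ, ϱ₀ ≤ ϱ →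
    ∀ (a b : E3) (w : ℤ → E3), IsLayeredCrystal c a b w → ∀ φ : Cell 2 → ℤ → E3, HasFiniteSupport φ →
      Summable (fun x : (Cell 2 × ℤ) × (Cell 2 × ℤ) =>
        if ϱ < ‖lsite a b w x.2.1 x.2.2 - lsite a b w x.1.1 x.1.2‖ then
          ‖layeredKernel a b w (x.2.1 - x.1.1) x.1.2 x.2.2‖ * ‖φ x.2.1 x.2.2 - φ x.1.1 x.1.2‖ ^ 2 else 0) ∧
      ∑' x : (Cell 2 × ℤ) × (Cell 2 × ℤ),
        (if ϱ < ‖lsite a b w x.2.1 x.2.2 - lsite a b w x.1.1 x.1.2‖ then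
          ‖layeredKernel a b w (x.2.1 - x.1.1) x.1.2 x.2.2‖ * ‖φ x.2.1 x.2.2 - φ x.1.1 x.1.2‖ ^ 2 else 0) ≤ ε * nnFormZ φ

/-- ★ **(U) «UniformEquilStability s Λ»** — UNIFORM harmonic stability of EQUILIBRIUM charts: for every scale `a > 0` there are `κ₀ > 0` and a
co-Lipschitz constant `c₀ > 0` such that every equilibrium chart `(L, w)` (`IsEquilChart a s Λ L w`: `s`-conformal about `a`, homogeneous state CLEAN
and single-site NASH) admits a re-indexing `w'` of its layers (same point set, in-plane generators `L t₁, L t₂`) which is `c₀`-co-Lipschitz AND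
`κ₀`-coercive in the layer-local currency (`CoerciveZ (layeredKernel …) κ₀`).  The UNIFORM form, restricted to equilibrium charts, of the column leaf
`LayeredCrystalStability` (which certifies `κ > 0` per structure); every use of Hessian positivity beneath (HD) is routed through it (rows 508/515).
STABILITY-type · UNDECIDED · TRUE-type-expected · INSTRUMENTABLE (census TAG 174 (a⁗): min λ_rel over the 2 % conformal slice × hollow words ≤ 4 at
the equilibrium gap, expected ≥ +0.15; CHAIN-MARGIN word-independent) · analytic closure M–L (periodic words: Bloch–Floquet; all words: the quadratic
form localises up to the (T)-tail, and depth-k stacking environments are finitely many — a finite census plus a localisation lemma).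
Why it might fail: a hollow equilibrium stacking word inside the conformal slice with a soft collective interlayer-shear mode (κ₀ ↓ 0 along a sequence of
words), or a co-Lipschitz constant degenerating at the edge of the clean window; either breaks uniformity, not per-structure stability.
Sources: [census TAG 174 (a″)/(a‴) rows, A174.md], [EMing2006 (Cauchy–Born stability of multilattices)], [Ayala–Choksi–Wirth arXiv:2506.22614],
[HudsonOrtner2012/OrtnerTheil2013 (lattice stability constants)]. [this file, g30] -/
def UniformEquilStability (s Λ : ℝ) : Prop :=
  ∀ a : ℝ, 0 < a → ∃ κ₀ : ℝ, 0 < κ₀ ∧ ∃ c₀ : ℝ, 0 < c₀ ∧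
    ∀ (L : E3 ≃L[ℝ] E3) (w : ℤ → E3), IsEquilChart a s Λ L w →
      ∃ w' : ℤ → E3,
        Layered ((L : E3 →L[ℝ] E3) (triangularVec₁ 1)) ((L : E3 →L[ℝ] E3) (triangularVec₂ 1)) w' = LayeredHom (L : E3 →L[ℝ] E3) w ∧
        IsLayeredCrystal c₀ ((L : E3 →L[ℝ] E3) (triangularVec₁ 1)) ((L : E3 →L[ℝ] E3) (triangularVec₂ 1)) w' ∧
        CoerciveZ (layeredKernel ((L : E3 →L[ℝ] E3) (triangularVec₁ 1)) ((L : E3 →L[ℝ] E3) (triangularVec₂ 1)) w') κ₀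

/-- ★★ **(A) «HarmonicApproxPGL aHi Λ θ s»** — DISCRETE HARMONIC APPROXIMATION FOR MINIMISERS, THE NEW RESIDUAL-DESIGNATE: given (T), (U) and the
layered Liouville certificate, for every `δ` and scale `a > 0` there is an amplification `C ≥ 1` such that for EVERY defect target `c' > 0` and every
prescribed range floor `ϱ₁ ≥ 1` there are a range `ϱ ≥ ϱ₁`, a shrink factor `M ≥ 2`, a ceiling `η₁` and a floor `R₁` with: on θ-good `aHi`-GSC door sets,
«registered-flat at `(R, η)` under an equilibrium `s`-chart ⇒ the root window at radius `R/M` SPLITS into a `ϱ`-truncated-harmonic model field at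
level `C·η` plus a defect at level `c'·η`».  Mechanism: repair tears of the registration (surgery on clean sets: torn atoms are `ℓ²`-few and have a
consistent free site); `h` := the minimiser of the truncated quadratic Dirichlet energy on the model ball with data `u ∘ Ψ⁻¹` (coercive by (U) minus
(T)); `u − h` small by MINIMALITY TRANSFER from e⋆-GSC (competitor = atoms moved by `h ∘ Ψ` inside, untouched outside; reference force-free because
the chart is an equilibrium chart); in-window tail = `H⁻¹` source of size `ε(ϱ) M³ η` by (T); far field (sources `≥ R/2` away) slaved to `η` by force
balance and smooth on scale `R`, hence GENERIC of size `≲ η/M²`.  MINIMALITY + REGISTRATION-type; UNDECIDED · TRUE-type · ATTACKABLE·L.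
Why it might fail: the cubic Taylor error is `Σ|∇u|³`, controlled by `ℓ²` only on TAME sites — the misfit carried by O(1)-rotation sites must be `o(η·#)`
(ε-regularity of the bad set: needs e⋆-GSC to exclude rotated grains; smooth accumulated rotation is absorbed by `h`), else `c' ↛ 0`.
Sources: [giaquinta1984 p.120 Thm 3.1; Ch. VI pp 94–122 (harmonic approximation / Campanato)], [DuzaarGrotowski2000 (A-harmonic approximation)],
[kruzik2019 p.55 Thm 1.1.12 (FJM rigidity)], [Theil2006], [EMing2006], [Goldman–Otto (variational harmonic approximation)]. [this file, g30] -/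
def HarmonicApproxPGL (aHi Λ θ s : ℝ) : Prop :=
  TailDominationCert → UniformEquilStability s Λ → LayeredLiouvilleCert →
    ∀ δ : ℝ, 0 < δ → ∀ a : ℝ, 0 < a → ∃ C : ℝ, 1 ≤ C ∧ ∀ c' : ℝ, 0 < c' → ∀ ϱ₁ : ℝ, 1 ≤ ϱ₁ →
      ∃ ϱ : ℝ, ϱ₁ ≤ ϱ ∧ ∃ M : ℝ, 2 ≤ M ∧ ∃ η₁ : ℝ, 0 < η₁ ∧ ∃ R₁ : ℝ, 0 < R₁ ∧
        ∀ S : Set E3, IsDoorSetPG aHi δ S → (∀ q ∈ S, IsTwoShellAffineGood θ S q) →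
          ∀ η : ℝ, 0 < η → η ≤ η₁ → ∀ R : ℝ, R₁ ≤ R →
            NearHomH1BDE a s Λ η 4 R S (atomsIn (μS S) 0 R) → NearHarmSplitE a s Λ ϱ (C * η) (c' * η) 4 (R / M) S

/-- ★★ **(D) «SplitDecayPL aHi Λ θ s s'»** — DECAY OF THE STRUCTURED PART + RE-CHART, GSC-FREE BY TYPE (door `IsDoorSetP`: rooted, separated, clean,
Nash, charted — NO minimality): given (T), (U) and the layered Liouville certificate, for every `δ` and scale `a > 0` there are a constant `C > 0`
and a range floor `ϱ₁ ≥ 1` such that for EVERY range `ϱ ≥ ϱ₁` and EVERY ratio `t ∈ (0, 1/2]` (ceiling `η₁` and floor `R₁` depending on them):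
«split at `(ρ; κh, κd)` under an equilibrium `s`-chart ⇒ registered-flat (`NearHomH1BDE`, part Q) at radius `t ρ` under a NEW equilibrium `s'`-chart
at level `C·(t² κh + κd / t³)`» — the structured part DECAYS (`t²`: affine-layered Taylor remainder of a truncated-harmonic field, interior estimate
uniform in `ϱ ≥ ϱ₁` by (U) − (T)), the generic part is CARRIED (`t⁻³` = volume ratio of the windows).  Re-chart: Taylor part `p ↦ B p + c(layer p)`
↦ chart `((I+B)L, (I+B)w + c)`, an equilibrium chart up to a re-equilibration of size `O(κh²) ≤ t² κh` below the ceiling; `IsConfChart a s'` from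
`|B| ≤ C√κh ≤ s' − s`; position level by discrete Poincaré after a free translation; two-sided `EnvClose` re-derived from cleanliness of `S` and of
the chart, tolerance = local increments, the non-surjective sites (defect profile `≥ 1/8`) charged `16·64 κd`.  LINEAR + RE-CHART-type;
UNDECIDED · TRUE-type · ATTACKABLE·M–L (qualitative form of the decay = `LayeredLiouvilleCert`; designated sub-cut D ⟸ D₁ interior decay ∧ D₂ re-chart).
Why it might fail: the exponent 2 needs a C²-type interior estimate for the truncated laminate operator UNIFORM over equilibrium stacking words
(a C^{1,α} estimate gives `t^{1+α}`, still enough for (HD) after re-gluing); images of `win (t ρ)` must sit inside the harmonic model ball — guaranteed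
only by tear-freeness (`|Ψ x − Ψ 0| ≤ 3|x| + 16`), whence the floors.
Sources: [giaquinta1984 pp 94–122, Ch. III (Campanato)], [hildebrandt1988 p.84], [EMing2006], [kruzik2019 p.55], [this tree: part B
`linLiouville_of_boundedFlat_of_gammaKernelBdd` (affine-layered = tangent of `Layered`)]. [this file, g30] -/
def SplitDecayPL (aHi Λ θ s s' : ℝ) : Prop :=
  TailDominationCert → UniformEquilStability s Λ → LayeredLiouvilleCert →
    ∀ δ : ℝ, 0 < δ → ∀ a : ℝ, 0 < a → ∃ C : ℝ, 0 < C ∧ ∃ ϱ₁ : ℝ, 1 ≤ ϱ₁ ∧ ∀ ϱ : ℝ, ϱ₁ ≤ ϱ → ∀ t : ℝ, 0 < t → t ≤ 1 / 2 →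
      ∃ η₁ : ℝ, 0 < η₁ ∧ ∃ R₁ : ℝ, 0 < R₁ ∧
        ∀ S : Set E3, IsDoorSetP aHi δ S → (∀ q ∈ S, IsTwoShellAffineGood θ S q) →
          ∀ κh : ℝ, 0 < κh → κh ≤ η₁ → ∀ κd : ℝ, 0 < κd → κd ≤ η₁ → ∀ ρ : ℝ, R₁ ≤ ρ →
            NearHarmSplitE a s Λ ϱ κh κd 4 ρ S →
              NearHomH1BDE a s' Λ (C * (t ^ 2 * κh + κd / t ^ 3)) 4 (t * ρ) S (atomsIn (μS S) 0 (t * ρ))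

/-! ## §III.3  ★★★ The glue: (HD) ⟸ (T) ∧ (U) ∧ (A) ∧ (D) — PROVED (pure bookkeeping of levels, ranges and radii) -/

/-- ★★★ **(HD)(aHi;Λ,θ,s,s') ⟸ (T) ∧ (U)(s,Λ) ∧ (A)(aHi;Λ,θ,s) ∧ (D)(aHi;Λ,θ,s,s') (PROVED)**.  Given the contraction target `c`: `C_A` from (A),
`C_d, ϱ₁` from (D); `t₀ := min (1/2) (c / (2 C_d C_A + c))` (so `C_d C_A t₀² ≤ C_d C_A t₀ ≤ c/2`), defect target `c' := c t₀³ / (2 C_d)` (so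
`C_d c' / t₀³ = c/2`); (A) at `(c', ϱ₁)` gives `ϱ ≥ ϱ₁`, `M ≥ 2`, `η_A`, `R_A`; (D) at `(ϱ, t₀)` gives `η_D`, `R_D`; then (HD) holds with
`t := t₀ / M`, ceiling `min η_A (min (η_D / C_A) (η_D / c'))`, floor `max R_A (M R_D)`: registered `η` at `R` —(A)→ split `(C_A η, c' η)` at `R/M`
—(D)→ registered `C_d (t₀² C_A + c'/t₀³) η ≤ c η` at `t₀ R / M`. [this file, g30] -/
theorem harmonicDecayPGL_of_tail_unif_approx_decay {aHi Λ θ s s' : ℝ} (hT : TailDominationCert) (hU : UniformEquilStability s Λ)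
    (hA : HarmonicApproxPGL aHi Λ θ s) (hD : SplitDecayPL aHi Λ θ s s') : HarmonicDecayPGL aHi Λ θ s s' := by
  intro _ hL' δ hδ a ha c hc
  obtain ⟨CA, hCA, hA'⟩ := hA hT hU hL' δ hδ a ha
  obtain ⟨Cd, hCd, ϱ₁, hϱ₁, hD'⟩ := hD hT hU hL' δ hδ a ha
  have hCA0 : 0 < CA := zero_lt_one.trans_le hCA
  -- the ratio `t₀` and the defect target `c'`
  set t₀ : ℝ := min (1 / 2) (c / (2 * Cd * CA + c)) with ht₀def
  have ht₀ : 0 < t₀ := lt_min (by norm_num) (div_pos hc (by positivity))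
  have ht₀half : t₀ ≤ 1 / 2 := min_le_left _ _
  have ht₀le : t₀ ≤ c / (2 * Cd * CA + c) := min_le_right _ _
  have ht₀one : t₀ ≤ 1 := ht₀half.trans (by norm_num)
  set c' : ℝ := c * t₀ ^ 3 / (2 * Cd) with hc'def
  have hc' : 0 < c' := by positivity
  obtain ⟨ϱ, hϱ, M, hM, ηA, hηA, RA, hRA, hA''⟩ := hA' c' hc' ϱ₁ hϱ₁
  obtain ⟨ηD, hηD, RD, hRD, hD''⟩ := hD' ϱ hϱ t₀ ht₀ ht₀half
  have hM0 : 0 < M := zero_lt_two.trans_le hM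
  have hM1 : 1 ≤ M := one_le_two.trans hM
  refine ⟨t₀ / M, div_pos ht₀ hM0, (div_le_self ht₀.le hM1).trans ht₀one,
    min ηA (min (ηD / CA) (ηD / c')), lt_min hηA (lt_min (div_pos hηD hCA0) (div_pos hηD hc')),
    max RA (M * RD), lt_max_of_lt_left hRA, fun S hSd hg η hη hηle R hR hreg => ?_⟩
  have hRA_R : RA ≤ R := (le_max_left _ _).trans hR
  have hRD_R : RD ≤ R / M := by
    rw [le_div_iff₀ hM0]
    calc RD * M = M * RD := mul_comm _ _
      _ ≤ R := (le_max_right _ _).trans hR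
  -- step (A): registered-flat at `R` ⇒ split at `R / M`
  have h1 := hA'' S hSd hg η hη (hηle.trans (min_le_left _ _)) R hRA_R hreg
  -- step (D): split at `ρ := R / M` ⇒ registered-flat at `t₀ ρ`
  have hlevA : CA * η ≤ ηD := by
    have h := hηle.trans ((min_le_right _ _).trans (min_le_left _ _))
    rw [le_div_iff₀ hCA0] at h
    linarith
  have hlevc : c' * η ≤ ηD := by
    have h := hηle.trans ((min_le_right _ _).trans (min_le_right _ _))
    rw [le_div_iff₀ hc'] at h
    linarith
  have h2 := hD'' S hSd.1 hg (CA * η) (by positivity) hlevA (c' * η) (by positivity) hlevc (R / M) hRD_R h1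
  -- the level: `Cd (t₀² CA η + c' η / t₀³) = Cd CA t₀² η + (c/2) η ≤ c η`
  have hCdCA : Cd * CA * t₀ ≤ c / 2 := by
    have h3 : Cd * CA * (c / (2 * Cd * CA + c)) ≤ c / 2 := by
      rw [mul_div_assoc', div_le_iff₀ (by positivity)]
      nlinarith [mul_pos hc hc, mul_pos (mul_pos hCd hCA0) hc]
    exact (mul_le_mul_of_nonneg_left ht₀le (by positivity)).trans h3
  have hsq : t₀ ^ 2 ≤ t₀ := by nlinarith
  have hdef : Cd * (c' * η / t₀ ^ 3) = c / 2 * η := by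
    rw [hc'def]
    field_simp
  have hlev : Cd * (t₀ ^ 2 * (CA * η) + c' * η / t₀ ^ 3) ≤ c * η := by
    have h4 : Cd * (t₀ ^ 2 * (CA * η)) ≤ c / 2 * η := by
      have h5 : Cd * (t₀ ^ 2 * (CA * η)) = Cd * CA * t₀ ^ 2 * η := by ring
      rw [h5]
      apply mul_le_mul_of_nonneg_right _ hη.le
      calc Cd * CA * t₀ ^ 2 ≤ Cd * CA * t₀ := mul_le_mul_of_nonneg_left hsq (by positivity)
        _ ≤ c / 2 := hCdCA
    calc Cd * (t₀ ^ 2 * (CA * η) + c' * η / t₀ ^ 3) = Cd * (t₀ ^ 2 * (CA * η)) + Cd * (c' * η / t₀ ^ 3) := by ring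
      _ ≤ c / 2 * η + c / 2 * η := add_le_add h4 hdef.le
      _ = c * η := by ring
  have hrad : t₀ * (R / M) = t₀ / M * R := by
    field_simp
  rw [hrad] at h2
  exact nearHomH1BDE_mono hlev h2

/-- ★★ **H♭^ℓ ⟸ (P) ∧ (T) ∧ (U) ∧ (A) ∧ (D) ∧ (C) (PROVED)** — part Q's glue with (HD) resolved. [this file, g30] -/
theorem halvingBasinPGL_of_reg_split_cacc {aHi Λ θ s s' : ℝ} (hP : RegistrationP aHi Λ θ s) (hT : TailDominationCert)
    (hU : UniformEquilStability s Λ) (hA : HarmonicApproxPGL aHi Λ θ s) (hD : SplitDecayPL aHi Λ θ s s')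
    (hC : CaccioppoliPGL aHi Λ θ s') : HalvingBasinPGL aHi Λ θ s :=
  halvingBasinPGL_of_reg_harm_cacc hP (harmonicDecayPGL_of_tail_unif_approx_decay hT hU hA hD) hC

/-! ## §III.4  ★ Columns (`s = 1/50`, corrected-chart tolerance `s' = 1/25`) -/

/-- ★★★ **COLUMN `_16XH4` — TWELVE opaque leaves, THE COLUMN OF THIS NODE**: `LatticeLiouvilleCert → LayeredLiouvilleCert → R_G(1;2,1/16,1/16) →
X(1;2,1/16,1/16) → Z_E(1;2,1/16,1/50) → P(1;2,1/16,1/50) → T → U(1/50,2) → A(1;2,1/16,1/50) → D(1;2,1/16,1/50,1/25) → C(1;2,1/16,1/25) →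
PeriodicBulkGapDoor 2 → VisibleGap (1/50) ∧ PertRegime (1/50)`. [this file, g30] -/
theorem gap_and_pert_1_50_of_certs_16XH4 (hL : LatticeLiouvilleCert) (hL' : LayeredLiouvilleCert)
    (hR : OscRigidityL2BDPG 1 2 (1 / 16) (1 / 16)) (hX : ExcessFlatnessControlP 1 2 (1 / 16) (1 / 16))
    (hE : ExcessChartLocalisationP 1 2 (1 / 16) (1 / 50)) (hP : RegistrationP 1 2 (1 / 16) (1 / 50))
    (hT : TailDominationCert) (hU : UniformEquilStability (1 / 50) 2) (hA : HarmonicApproxPGL 1 2 (1 / 16) (1 / 50))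
    (hDd : SplitDecayPL 1 2 (1 / 16) (1 / 50) (1 / 25)) (hCc : CaccioppoliPGL 1 2 (1 / 16) (1 / 25))
    (hG : PeriodicBulkGapDoor 2) : VisibleGap (1 / 50) ∧ PertRegime (1 / 50) :=
  gap_and_pert_1_50_of_certs_16XH3 hL hL' hR hX hE hP (harmonicDecayPGL_of_tail_unif_approx_decay hT hU hA hDd) hCc hG

/-- ★★ **COLUMN `_16XH4`, resolved form — SIXTEEN leaves (the audit column)**: `LJDecay → LJMoments → CleanCrystalStability → LayeredDecay →
LayeredMoments → LayeredCrystalStability → R_G → X → Z_E → P → T → U → A → D → C → HBG″ → VisibleGap (1/50) ∧ PertRegime (1/50)`. [this file, g30] -/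
theorem gap_and_pert_1_50_of_layered_pieces_16XH4 (hD : LJDecay) (hM : LJMoments) (hC : CleanCrystalStability)
    (hD' : LayeredDecay) (hM' : LayeredMoments) (hC' : LayeredCrystalStability)
    (hR : OscRigidityL2BDPG 1 2 (1 / 16) (1 / 16)) (hX : ExcessFlatnessControlP 1 2 (1 / 16) (1 / 16))
    (hE : ExcessChartLocalisationP 1 2 (1 / 16) (1 / 50)) (hP : RegistrationP 1 2 (1 / 16) (1 / 50))
    (hT : TailDominationCert) (hU : UniformEquilStability (1 / 50) 2) (hA : HarmonicApproxPGL 1 2 (1 / 16) (1 / 50))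
    (hDd : SplitDecayPL 1 2 (1 / 16) (1 / 50) (1 / 25)) (hCc : CaccioppoliPGL 1 2 (1 / 16) (1 / 25))
    (hG : PeriodicBulkGapDoor 2) : VisibleGap (1 / 50) ∧ PertRegime (1 / 50) :=
  gap_and_pert_1_50_of_layered_pieces_16XH3 hD hM hC hD' hM' hC' hR hX hE hP
    (harmonicDecayPGL_of_tail_unif_approx_decay hT hU hA hDd) hCc hG

end Summit.AtomisticToContinuum.Crystallization.Theorems.ChartedZeroExcessLayeredLatticeLiouville

end
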